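import Summits.CriticalPhenomena.PercolationContinuityZ3.Theorems.PercNearOneGluingNoHeavyLowerTailUpwardTransportOneLayer
import Summits.CriticalPhenomena.PercolationContinuityZ3.Theorems.PercNearOneGluingNoHeavyLowerTailSteinerBlobMeasure
import HarnessLib

/-!
# `NoHeavyLowerTail` (stmt-CriticalPhenomena-4575) — the upward-transport comparison `UT` (relay-set form) for observers of
# ARBITRARY DEPTH at a uniformly port-dominating designee

Lemma factory #6 (`prim-lf-6`, gen 4), 2026-08-19; capstone of candidate B4.2 (`run/shared/lean/prim/prim-lf-6/CANDIDATES.md`): the one-layer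
theorem `UpwardTransport.oneLayer_transport` transported through the Steiner-blob decomposition (`…SteinerBlobContraction`,
`…SteinerBlobMeasure`).  For every up-set `𝒰` of RELAY sets (the relay-set shadow of the edge up-sets of the typed target
`noHeavyLowerTail_of_upwardTransport`; edge up-sets inside the blob are not seen by the contraction) and every relay `c` that is, for every
blob `V₀ ∋ o` disjoint from `A`, at least as fragile AVOIDING `V₀` as every relay adjacent to `V₀`:

  `μ(π(o) ∈ 𝒰, o ↮ c, |π(o)| ≥ 1, |π(c)| > j) ≤ μ(π(o) ∈ 𝒰, o ↮ c, |π(o)| > j)`     (all `|A|`, all `j`, any depth).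

Proof: per blob, the events are read on the contraction (`SteinerBlob.reachable_contract_iff`), `Blob(V₀)` is independent of it and
`Ψ_*μ_w = μ_{w̃}`; on the blob-weight graph the observer is one-layer and `c` satisfies Kozma–Nitzan's off-`o` criterion
(`SteinerBlob.blobWeight_real_smallOff_eq`), so `oneLayer_transport` applies with the edge up-set `{C | relays reached from o inside C ∈ 𝒰}`;
sum over the blob partition.  No definitions, no sorries.
-/

namespace Summit.CriticalPhenomena.PercolationContinuityZ3.Theorems

open MeasureTheory Set Literature.Probability.LatticeModels Literature.Probability.Percolation
open scoped Classical BigOperators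

variable {n : ℕ}

open SteinerBlob UpwardTransport in
/-- **UT (relay-set form) at a uniformly port-dominating designee, any depth.** [this work] -/
theorem upwardTransportRelays_of_portDominated (w : Sym2 (Fin n) → unitInterval) (A : Finset (Fin n)) (o c : Fin n) (j : ℕ)
    (𝒰 : Set (Finset (Fin n))) (h𝒰 : IsUpperSet 𝒰) (hoA : o ∉ A) (hc : c ∈ A)
    (hdom : ∀ V₀ : Finset (Fin n), o ∈ V₀ → Disjoint V₀ A →
      ∀ v ∈ A, (∃ u ∈ V₀, w s(u, v) ≠ 0) →
        (prodBernoulli w).real {ω : BondConfig (Fin n) |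
            (A.filter fun z => ω ∈ openConnIn ((↑V₀ : Set (Fin n))ᶜ) v z).card ≤ j} ≤
          (prodBernoulli w).real {ω : BondConfig (Fin n) |
            (A.filter fun z => ω ∈ openConnIn ((↑V₀ : Set (Fin n))ᶜ) c z).card ≤ j}) :
    (prodBernoulli w).real ({ω : BondConfig (Fin n) | (A.filter fun z => ω ∈ openConn o z) ∈ 𝒰} ∩
        {ω | ω ∉ (openConn o c : Set (BondConfig (Fin n)))} ∩
        {ω | 1 ≤ (A.filter fun z => ω ∈ openConn o z).card} ∩
        {ω | j < (A.filter fun z => ω ∈ openConn c z).card}) ≤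
      (prodBernoulli w).real ({ω : BondConfig (Fin n) | (A.filter fun z => ω ∈ openConn o z) ∈ 𝒰} ∩
        {ω | ω ∉ (openConn o c : Set (BondConfig (Fin n)))} ∩
        {ω | j < (A.filter fun z => ω ∈ openConn o z).card}) := by
  set μ := prodBernoulli w with hμ
  have hco : c ≠ o := fun h => hoA (h ▸ hc)
  set L : Set (BondConfig (Fin n)) := {ω : BondConfig (Fin n) | (A.filter fun z => ω ∈ openConn o z) ∈ 𝒰} ∩
        {ω | ω ∉ (openConn o c : Set (BondConfig (Fin n)))} ∩
        {ω | 1 ≤ (A.filter fun z => ω ∈ openConn o z).card} ∩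
        {ω | j < (A.filter fun z => ω ∈ openConn c z).card} with hL
  set R : Set (BondConfig (Fin n)) := {ω : BondConfig (Fin n) | (A.filter fun z => ω ∈ openConn o z) ∈ 𝒰} ∩
        {ω | ω ∉ (openConn o c : Set (BondConfig (Fin n)))} ∩
        {ω | j < (A.filter fun z => ω ∈ openConn o z).card} with hR
  rw [← sum_measureReal_inter_blob w A o hoA L, ← sum_measureReal_inter_blob w A o hoA R]
  refine Finset.sum_le_sum fun V₀ hV₀ => ?_
  obtain ⟨ho, hVA⟩ := (Finset.mem_filter.1 hV₀).2
  -- per blob: read the events on the contraction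
  set Ψ : BondConfig (Fin n) → BondConfig (Fin n) := fun ω =>
    ({e : Sym2 (Fin n) | (e ∈ ω ∧ ∀ v ∈ e, v ∉ V₀) ∨
      ∃ a ∈ A, e = s(o, a) ∧ ∃ u ∈ V₀, s(u, a) ∈ ω} : BondConfig (Fin n)) with hΨ
  set q : Sym2 (Fin n) → unitInterval := fun e =>
    ⟨μ.real {ω : BondConfig (Fin n) | e ∈ Ψ ω}, ⟨measureReal_nonneg, measureReal_le_one⟩⟩ with hq
  set μ' := prodBernoulli q with hμ'
  set Bl : Set (BondConfig (Fin n)) := {ω : BondConfig (Fin n) | (∀ u ∈ V₀, ω ∈ openConnIn (↑V₀ : Set (Fin n)) o u) ∧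
      ∀ u ∈ V₀, ∀ x, x ∉ V₀ → x ∉ A → s(u, x) ∉ ω} with hBl
  have hAV : ∀ {z}, z ∈ A → z ∉ V₀ := fun hz h => Finset.disjoint_left.1 hVA h hz
  have hreach : ∀ ω ∈ Bl, ∀ {x}, (x = o ∨ x ∉ V₀) → ∀ z ∈ A,
      (ω ∈ (openConn x z : Set (BondConfig (Fin n))) ↔ Ψ ω ∈ (openConn x z : Set (BondConfig (Fin n)))) :=
    fun ω hω x hx z hz => reachable_contract_iff ho hVA hω hx (Or.inr (hAV hz))
  have hfilter : ∀ ω ∈ Bl, ∀ {x}, (x = o ∨ x ∉ V₀) →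
      (A.filter fun z => ω ∈ openConn x z) = A.filter fun z => Ψ ω ∈ openConn x z :=
    fun ω hω x hx => Finset.filter_congr fun z hz => hreach ω hω hx z hz
  have hoc : ∀ ω ∈ Bl, (ω ∈ (openConn o c : Set (BondConfig (Fin n))) ↔ Ψ ω ∈ (openConn o c : Set (BondConfig (Fin n)))) :=
    fun ω hω => hreach ω hω (Or.inl rfl) c hc
  have eL : L ∩ Bl = Bl ∩ Ψ ⁻¹' L := by
    ext ω
    simp only [hL, mem_inter_iff, mem_preimage, mem_setOf_eq]
    constructor
    · rintro ⟨⟨⟨⟨h1, h2⟩, h3⟩, h4⟩, hω⟩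
      rw [hfilter ω hω (Or.inl rfl)] at h1 h3; rw [hoc ω hω] at h2; rw [hfilter ω hω (Or.inr (hAV hc))] at h4
      exact ⟨hω, ⟨⟨h1, h2⟩, h3⟩, h4⟩
    · rintro ⟨hω, ⟨⟨h1, h2⟩, h3⟩, h4⟩
      rw [← hfilter ω hω (Or.inl rfl)] at h1 h3; rw [← hoc ω hω] at h2; rw [← hfilter ω hω (Or.inr (hAV hc))] at h4
      exact ⟨⟨⟨⟨h1, h2⟩, h3⟩, h4⟩, hω⟩
  have eR : R ∩ Bl = Bl ∩ Ψ ⁻¹' R := by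
    ext ω
    simp only [hR, mem_inter_iff, mem_preimage, mem_setOf_eq]
    constructor
    · rintro ⟨⟨⟨h1, h2⟩, h3⟩, hω⟩
      rw [hfilter ω hω (Or.inl rfl)] at h1 h3; rw [hoc ω hω] at h2
      exact ⟨hω, ⟨h1, h2⟩, h3⟩
    · rintro ⟨hω, ⟨h1, h2⟩, h3⟩
      rw [← hfilter ω hω (Or.inl rfl)] at h1 h3; rw [← hoc ω hω] at h2
      exact ⟨⟨⟨h1, h2⟩, h3⟩, hω⟩
  -- the one-layer transport on the blob-weight graph
  set U : Set (Set (Sym2 (Fin n))) :=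
    {C | (A.filter fun z => (SimpleGraph.fromEdgeSet C).Reachable o z) ∈ 𝒰} with hUdef
  have hUup : IsUpperSet U := by
    intro C C' hCC' hC
    refine h𝒰 ?_ hC
    exact Finset.monotone_filter_right A fun z _ hz => hz.mono (SimpleGraph.fromEdgeSet_mono hCC')
  have hUev : {η : BondConfig (Fin n) | openEdgeCluster η o ∈ U} =
      {η : BondConfig (Fin n) | (A.filter fun z => η ∈ openConn o z) ∈ 𝒰} := by
    ext η
    simp only [hUdef, mem_setOf_eq]
    have : (A.filter fun z => (SimpleGraph.fromEdgeSet (openEdgeCluster η o)).Reachable o z) =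
        A.filter fun z => η ∈ (openConn o z : Set (BondConfig (Fin n))) := by
      refine Finset.filter_congr fun z _ => ⟨fun h => ?_, fun h => ?_⟩
      · exact h.mono (SimpleGraph.fromEdgeSet_mono (openEdgeCluster_subset η o))
      · exact GuardedLonelyRelay.reachable_fromEdgeSet_openEdgeCluster h
    rw [this]
  have hiso : ∀ u, u ≠ o → u ∉ A → q s(o, u) = 0 := fun u huo huA => blobWeight_eq_zero w ho huo huA
  have hoff : ∀ v ∈ A, q s(o, v) ≠ 0 →
      μ'.real {η : BondConfig (Fin n) | (A.filter fun z => η ∈ openConnIn ({o}ᶜ : Set (Fin n)) v z).card ≤ j} ≤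
        μ'.real {η : BondConfig (Fin n) | (A.filter fun z => η ∈ openConnIn ({o}ᶜ : Set (Fin n)) c z).card ≤ j} := by
    intro v hvA hv
    rw [hμ', blobWeight_real_smallOff_eq w ho hVA j (hAV hvA), blobWeight_real_smallOff_eq w ho hVA j (hAV hc)]
    exact hdom V₀ ho hVA v hvA (exists_weight_ne_zero_of_blobWeight_ne_zero w ho hVA hvA hv)
  have ut := oneLayer_transport q A o c j U hUup hoA hc hiso hoff
  rw [hUev] at ut
  change μ'.real L ≤ μ'.real R at ut
  calc μ.real (L ∩ Bl) = μ.real (Bl ∩ Ψ ⁻¹' L) := by rw [eL]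
    _ = μ.real Bl * μ.real (Ψ ⁻¹' L) := measureReal_blob_inter_preimage_contract w hVA L
    _ = μ.real Bl * μ'.real L := by rw [measureReal_preimage_contract w hVA L]
    _ ≤ μ.real Bl * μ'.real R := mul_le_mul_of_nonneg_left ut measureReal_nonneg
    _ = μ.real Bl * μ.real (Ψ ⁻¹' R) := by rw [measureReal_preimage_contract w hVA R]
    _ = μ.real (Bl ∩ Ψ ⁻¹' R) := (measureReal_blob_inter_preimage_contract w hVA R).symm
    _ = μ.real (R ∩ Bl) := by rw [eR]

end Summit.CriticalPhenomena.PercolationContinuityZ3.Theorems
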